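/-
Copyright (c) 2026. Released under Apache 2.0 license.
-/
import Literature.Combinatorics.Words.FineWilf
import HarnessLib

/-!
# The conjugacy equation `xz = zy`

Lothaire, *Combinatorics on Words* (1997), Proposition 1.3.4, the precise form: for a non-empty word
`x`, the equation `xz = zy` holds iff there are words `u`, `v` and `k ≥ 0` with

  `x = uv`, `y = vu`, `z = (uv)ᵏ u`

(`exists_wordPow_of_append_eq_append`, `append_eq_append_iff_exists_wordPow`; hence `z` is a
prefix of a power of `x`, eq. (1.3.5), `prefix_wordPow_of_append_eq_append`).  The weaker
statement '`x` and `y` are conjugate iff `xz = zy` for some `z`' is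
`isRotated_iff_exists_append_eq` of `Words/Primitivity.lean` (Crochemore–Hancart–Lecroq,
Prop. 1.14) and is not restated.  Powers of words are `wordPow` of `Words/FineWilf.lean`.

The proof is the book's induction: if `|z| < |x|` then `z` is a prefix of `x`, `x = zv`, `y = vz`
(`k = 0`); otherwise `x` is a prefix of `z`, `z = xz'` with `xz' = z'y`, and induction on `|z|`.

The same statement is formalised in Isabelle/HOL by Holub and Starosta (*Formalization of basic
combinatorics on words*, ITP 2021, LIPIcs 193, theorem `conjug`; AFP entry *Combinatorics on Words
Basics*), who read `xz = zy` as '`z` has the period root `x`'; the present file is an independent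
Lean transcription of Lothaire's text and claims no novelty.

## References

* [Lothaire1997] M. Lothaire, *Combinatorics on Words*, Cambridge University Press (1997),
  Proposition 1.3.4 (equations (1.3.2)–(1.3.5)).
-/

namespace Literature.Combinatorics.Words

variable {α : Type*}

/-- `(uv)ᵏ⁺¹ u = u (vu)ᵏ⁺¹`-type bookkeeping: `(uv)ᵏ u v u = (uv)ᵏ⁺¹ u`.
[folklore] -/
private theorem wordPow_append_succ (u v : List α) (k : ℕ) :
    wordPow (u ++ v) k ++ u ++ (v ++ u) = wordPow (u ++ v) (k + 1) ++ u := by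
  rw [wordPow_add, wordPow_one]; simp only [List.append_assoc]

/-- **Proposition 1.3.4 (Lothaire), the solutions of `xz = zy`**: if `x ≠ ε` and `xz = zy` then
`x = uv`, `y = vu` and `z = (uv)ᵏ u` for some words `u, v` and `k ≥ 0`.
[cite: Lothaire1997, Prop 1.3.4 (eq. (1.3.3))] -/
theorem exists_wordPow_of_append_eq_append {x y z : List α} (hx : x ≠ []) (h : x ++ z = z ++ y) :
    ∃ u v : List α, ∃ k : ℕ, x = u ++ v ∧ y = v ++ u ∧ z = wordPow (u ++ v) k ++ u := by
  induction hn : z.length using Nat.strong_induction_on generalizing z with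
  | _ n ih =>
    rcases Nat.lt_or_ge z.length x.length with hlt | hge
    · -- `z` is a proper prefix of `x`: `x = z v`, `y = v z`, `k = 0`
      have hzx : z <+: x := by
        have h1 : z <+: x ++ z := by rw [h]; exact List.prefix_append _ _
        exact List.prefix_of_prefix_length_le h1 (List.prefix_append _ _) hlt.le
      obtain ⟨v, rfl⟩ := hzx
      refine ⟨z, v, 0, rfl, ?_, by simp⟩
      rw [List.append_assoc] at h
      exact (List.append_cancel_left h).symm
    · -- `x` is a prefix of `z`: `z = x z'` with `x z' = z' y`, and induction
      have hxz : x <+: z := by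
        have h1 : x <+: z ++ y := by rw [← h]; exact List.prefix_append _ _
        exact List.prefix_of_prefix_length_le h1 (List.prefix_append _ _) hge
      obtain ⟨z', rfl⟩ := hxz
      have h' : x ++ z' = z' ++ y := by
        rw [List.append_assoc] at h
        exact List.append_cancel_left h
      have hlt : z'.length < n := by
        rw [← hn, List.length_append]
        have := List.length_pos_of_ne_nil hx
        omega
      obtain ⟨u, v, k, rfl, rfl, rfl⟩ := ih z'.length hlt h' rfl
      refine ⟨u, v, k + 1, rfl, rfl, ?_⟩
      simp only [wordPow_succ, List.append_assoc]

/-- Conversely, `x = uv`, `y = vu`, `z = (uv)ᵏ u` solve `xz = zy`.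
[cite: Lothaire1997, Prop 1.3.4 (eq. (1.3.3) ⇒ (1.3.2))] -/
theorem append_eq_append_of_wordPow (u v : List α) (k : ℕ) :
    (u ++ v) ++ (wordPow (u ++ v) k ++ u) = (wordPow (u ++ v) k ++ u) ++ (v ++ u) := by
  rw [wordPow_append_succ, ← List.append_assoc, ← wordPow_succ]

/-- **Proposition 1.3.4 (Lothaire 1997)**: for `x ≠ ε`, `xz = zy` iff `x = uv`, `y = vu`,
`z ∈ u(vu)* = (uv)*u` for some `u`, `v`. [cite: Lothaire1997, Prop 1.3.4] -/
theorem append_eq_append_iff_exists_wordPow {x y z : List α} (hx : x ≠ []) :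
    x ++ z = z ++ y ↔
      ∃ u v : List α, ∃ k : ℕ,
        x = u ++ v ∧ y = v ++ u ∧ z = wordPow (u ++ v) k ++ u := by
  constructor
  · exact exists_wordPow_of_append_eq_append hx
  · rintro ⟨u, v, k, rfl, rfl, rfl⟩
    exact append_eq_append_of_wordPow u v k

/-- Equation (1.3.5): a solution `z` of `xz = zy` (`x ≠ ε`) is a prefix of a power of `x`
(`z = xᵏ u` with `u` a prefix of `x`).
[cite: Lothaire1997, Prop 1.3.4 (eq. (1.3.5): z = xⁿ⁻¹u)] -/
theorem prefix_wordPow_of_append_eq_append {x y z : List α} (hx : x ≠ []) (h : x ++ z = z ++ y) :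
    ∃ n : ℕ, z <+: wordPow x n := by
  obtain ⟨u, v, k, rfl, rfl, rfl⟩ := exists_wordPow_of_append_eq_append hx h
  refine ⟨k + 1, ?_⟩
  rw [wordPow_add, wordPow_one]
  exact (List.prefix_append_right_inj _).mpr (List.prefix_append u v)

/-- In particular the two sides of a conjugacy equation have the same length, and `|z| ≡ |u|`
modulo `|x|`. [cite: Lothaire1997, Prop 1.3.4 (eq. (1.3.5))] -/
theorem length_eq_of_append_eq_append {x y z : List α} (h : x ++ z = z ++ y) :
    x.length = y.length := by
  have := congrArg List.length h
  simp only [List.length_append] at this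
  omega

/-- One instance of the parametrisation, `u = a`, `v = ba`, `k = 1`: `x = aba`, `y = baa`,
`z = (aba)·a`, and indeed `aba·abaa = abaa·baa` (`a ↦ 0`, `b ↦ 1`).
[cite: Lothaire1997, Prop 1.3.4 (an instance of eq. (1.3.3))] -/
example :
    ([0, 1, 0] : List ℕ) ++ (wordPow [0, 1, 0] 1 ++ [0]) =
      (wordPow [0, 1, 0] 1 ++ [0]) ++ [1, 0, 0] := by
  decide

end Literature.Combinatorics.Words
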